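import Mathlib
import Literature.Topology.FourManifolds.WhitneyModelSheets
import Literature.Topology.FourManifolds.EquidimensionalEmbedding
import HarnessLib

/-!
# Candidate proof of the registered stub `stub_compactModelRecognition`
(line `ancient-sphere-rigidity`, lead reshape r2, crux stmt-SmoothPoincare4-10869; the same stub is
shared verbatim with line `spineless-models`).

Statement (verbatim from `Lines/ancient-sphere-rigidity.lean`): an injective `C^∞` immersion of a
non-empty compact 4-manifold `N` into a connected Hausdorff 4-manifold `M` is a diffeomorphism onto it.

Proof (refuter-drefute, 2026-08-15; all ingredients are PROVED tree theorems / Mathlib):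
* equidimensional immersion ⇒ local diffeomorphism at every point:
  `Literature.Topology.FourManifolds.isLocalDiffeomorphAt_of_mfderiv_injective`
  (inverse function theorem on manifolds, Lee 2013 Thm 4.5);
* local diffeomorphism from a non-empty compact manifold to a connected T₂ manifold is onto:
  `IsLocalDiffeomorph.surjective_of_compactSpace` (image clopen; Hirsch Ch. 2 §1);
* bijective local diffeomorphism ⇒ diffeomorphism: Mathlib `IsLocalDiffeomorph.diffeomorphOfBijective`.
-/

open scoped Manifold ContDiff
open Function

namespace Summit.SmoothPoincare4.SmoothPoincare4.Cruxes.SubcylindricalRecognition.AncientSphereRigidity.Refuter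

/-- **Compact models are recognised** (Lee 2013, Thm 4.29 / Prop 4.8 / Thm 4.14): an injective
`C^∞` immersion of a non-empty compact 4-manifold into a connected 4-manifold is a diffeomorphism.
Sorry-free proof of the registered stub `stub_compactModelRecognition` (type verbatim). [folklore] -/
theorem stub_compactModelRecognition_proof :
    ∀ (N M : Type) [TopologicalSpace N] [T2Space N] [SecondCountableTopology N]
      [ChartedSpace (EuclideanSpace ℝ (Fin 4)) N] [IsManifold (𝓡 4) ∞ N] [CompactSpace N] [Nonempty N]
      [TopologicalSpace M] [T2Space M] [SecondCountableTopology M]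
      [ChartedSpace (EuclideanSpace ℝ (Fin 4)) M] [IsManifold (𝓡 4) ∞ M] [ConnectedSpace M]
      (φ : N → M), ContMDiff (𝓡 4) (𝓡 4) ∞ φ → Function.Injective φ →
      (∀ x : N, Function.Injective (mfderiv (𝓡 4) (𝓡 4) φ x)) →
      Nonempty (N ≃ₘ⟮𝓡 4, 𝓡 4⟯ M) := by
  intro N M _ _ _ _ _ _ _ _ _ _ _ _ _ φ hφ hinj himm
  -- (1) local diffeomorphism at every point (inverse function theorem, equal dimensions)
  have hloc : IsLocalDiffeomorph (𝓡 4) (𝓡 4) ∞ φ := fun x =>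
    Literature.Topology.FourManifolds.isLocalDiffeomorphAt_of_mfderiv_injective
      (I := 𝓡 4) (J := 𝓡 4) isOpen_univ (Set.mem_univ x) hφ.contMDiffOn
      (by exact_mod_cast le_top) rfl (himm x)
  -- (2) onto: image open (local diffeo) and closed (compact), `M` connected
  have hsurj : Surjective φ := hloc.surjective_of_compactSpace
  -- (3) bijective local diffeomorphism ⇒ diffeomorphism
  exact ⟨hloc.diffeomorphOfBijective ⟨hinj, hsurj⟩⟩

end Summit.SmoothPoincare4.SmoothPoincare4.Cruxes.SubcylindricalRecognition.AncientSphereRigidity.Refuter
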